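import Summits.QuantumFields.YangMills.Theorems.BalabanUVNodesN21ThresholdMixtureRStepFactors

/-!
# N21 (NE7c), strategy s3 «alternative currency», file 23 — THE RESAMPLING TOWER'S PER-STEP BINDERS (N)∕(Eoff)∕(Eon) IN DENSITY FORM AT THE TYPED (0.3):
# OFF statistics keep their marginal; ON summands are `≤ δ_loc ×` the receiver, `δ_loc` = the sup of def-R's `rratio` sum (junction of files 20–22 with 20m∕20n)

Seat `pub-ymgap-dag-n21-e` (R141 (C) fan-out, node N21 = NE7c `T4IndicatorShell.ShellWeightBound`, strategy s3), g8.  Lane: `--kind proof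
--supports stmt-QuantumFields-20292 --as helper` (K3⁗ `SpineGivenEndpointR13Sep`).  Count-neutral.  Imports file 20 (`…RStepFactors`, p512646) only.

THE QUESTION.  LENS nearmiss v10.0 (Card 29, `Sketch-nearmiss-g10.lean` §N; tree module 20n `…N21HistoriesResamplingTower`) realises print's ℝ
([Balaban1989LargeFieldI] (0.3) p. 176) on HISTORIES by the RESAMPLING LIFT and displays, per ℝ-step and per statistic `u`, the binder
(N)∕(Eoff) `hoff : (J s).map u = (Jpre s).map u` — «a statistic whose support misses the conditional-integration fibre keeps its marginal» — and
the lens's located note to this seat (bus l.17969) reads file 20's `integral_defect_factor_eq` as «the density face of "`t_{s′}(·|V_off)` exists exactly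
where `∫⌈_{fib} t_{s′} > 0`"».  THIS FILE types that junction at the CURRENT FIELD's level: for file 20's old-indexed post-ℝ summand
`normTerm(fib a)(c″·f″)(c·f)` (sharp factors fibre-independent, `c ≤ c″`, provisos on the factor-free parts) and ANY fibre-independent bounded
test function `h` (§1) ∕ ANY fibre-independent statistic `u` (§2):

* §1 ★ `integral_factor_normTerm_mul_eq_of_le`: `∫ normTerm(s)(c″f″)(c f)·h dV = ∫ c·f·h dV` — (0.4) per summand AGAINST OFF TEST FUNCTIONS (file 20 §4 is
  `h ≡ 1`; `T4ObservableTelescope.normTerm_mul_eq_of_fibreIndep` moves `h` into the integrated piece);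
* §2 ★★ `map_withDensity_rstepSummand_eq_of_le`: `(dV·normTerm(s)(c″f″)(c f)).map u = (dV·(c f)).map u` for `u` fibre-independent and measurable —
  LITERALLY 20n's `hoff`∕`hN` shape `(J s).map u = (Jpre s).map u` with `J s :=` the post-ℝ summand's law on the current field, `Jpre s :=` the sender's;
  so at the `V_k`-level the resampling lift's (N)∕(Eoff) are THEOREMS of the typed (0.3) under KT-26∕KT-28 — what 20n displays beyond this is the lift to
  the joint space of histories (NODE O's ROW B′);
* §3 the ON side (`hon`) in def-R's LETTERS: the R-stepped summand of sender `a` to receiver `a′` is `rterm r a′ · rratio r fib a a′` (`rfl`), so pointwise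
  ratio bounds `rratio_a ≤ δ_a` on the ON senders of one receiver give `Σ_{a ON} (J a).map u ≤ (Σ_a δ_a) • (Jpre a′).map u` for EVERY statistic `u` —
  20n's `hon` with the OFF side reduced to the receiver, and **`δ_loc := Σ_{a ON} sup_V rratio r fib a a′ V`** named in def-R's own letters (lens Card 30's
  one analytic input: print's small factor per erased component, [Balaban1989LargeFieldI] p.176 L18–26 — NODE O's ∕ def-R's to bound, DISPLAYED here).

HONEST FRAMING.  NE7c is NOT PRINTED and NOT PROVED.  [folklore] bookkeeping (one use of file 20 §4 with the test function moved into the piece;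
`withDensity`∕`map` evaluated on measurable sets); KT-26∕KT-28 are HYPOTHESES (def-R's ∕ def-χ's facts, files 20–22); nothing of Bałaban's asserted;
N21 NOT discharged; count-neutral; one finite 𝕋⁴ at fixed `ε`; NOT ℝ⁴ ∕ OS ∕ gap ∕ Clay.

CITATION HEADER (lean-in-tree rule 2026-08-18).  BY NAME: file 20 `integral_factor_normTerm_eq_of_le` ∕ `normTerm_factor_mul_of_le` ∕ `normTerm_factor_nonneg`;
b01 `B15.BasicStep.normTerm` ∕ `fibreIntegral`; def-R FILE 7 `Node00.rterm` ∕ `rratio`; `T4DressedR.FibreIndep`; `T4ObservableTelescope.TermProvisos` ∕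
`normTerm_mul_eq_of_fibreIndep` ∕ `integrable_mul_bdd`.  Context only (SHAPE): [Balaban1989LargeFieldI] (0.3)–(0.4) p. 176, L18–26 («the quotients are still small»).

WHAT IS PROVED ([folklore]).  §1 ★ `integral_factor_normTerm_mul_eq_of_le`; §2 `fibreIndep_comp_statistic` · `lintegral_ofReal_preimage_eq` ·
★★ `map_withDensity_rstepSummand_eq_of_le`; §3 `withDensity_normTerm_le_smul` · ★ `sum_withDensity_normTerm_le_smul` · ★★ `sum_map_withDensity_normTerm_le` ·
`normTerm_rterm_eq_mul_rratio`; §4 (guard, non-vacuity) `fibreIntegral_one` · `termProvisos_one` · ★ `integral_ropReal_factor_eq_of_le_inhabited`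
(constant sharp factors are fibre-independent by `rfl` — `T4PairResponseWindow.fibreIndep_const`, not imported).
-/

set_option autoImplicit false

noncomputable section

open MeasureTheory Set
open scoped BigOperators ENNReal

namespace Summit.QuantumFields.YangMills.Theorems.N21ThresholdMixtureRStepMarginals

open Literature.MathematicalPhysics.QuantumFieldTheory.Balaban1983to89
open Literature.MathematicalPhysics.QuantumFieldTheory.Balaban1983to89.B15.BasicStep (fibreIntegral normTerm)
open Literature.MathematicalPhysics.QuantumFieldTheory.Balaban1983to89.T4DressedR (FibreIndep)
open Literature.MathematicalPhysics.QuantumFieldTheory.Balaban1983to89.T4ObservableTelescope (TermProvisos normTerm_mul_eq_of_fibreIndep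
  integrable_mul_bdd)
open Summit.QuantumFields.YangMills.Theorems.N21ThresholdMixtureRStepFactors

variable {P : Params} {j : ℕ} {G : Type*} [GaugeGroup G] [MeasurableSpace G] [HaarData G]
variable [DecidableEq (PBond P j)]

/-! ## §1 (0.4) per summand against fibre-independent test functions -/

section TestFunction

/-- ★ **(0.4) PER SUMMAND AGAINST AN OFF TEST FUNCTION**: for fibre-independent bounded sharp factors `c ≤ c″`, provisos on the factor-free parts, and
a fibre-independent bounded measurable `h ≥ 0`, `∫ normTerm(s)(c″f″)(c f)·h dV = ∫ c·f·h dV`. [cite: Balaban1989LargeFieldI, (0.4) p.176] -/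
theorem integral_factor_normTerm_mul_eq_of_le (s : Finset (PBond P j)) {c c'' f f'' h : Density P j G} {C B Bh : ℝ}
    (hP : TermProvisos s f'' f C) (hcm : Measurable c) (hc''m : Measurable c'') (hc : FibreIndep s c) (hc'' : FibreIndep s c'')
    (hc0 : ∀ V, 0 ≤ c V) (hc''0 : ∀ V, 0 ≤ c'' V) (hcB : ∀ V, c V ≤ B) (hle : ∀ V, c V ≤ c'' V)
    (hhm : Measurable h) (hh : FibreIndep s h) (hh0 : ∀ V, 0 ≤ h V) (hhB : ∀ V, h V ≤ Bh) :
    ∫ V, normTerm s (fun U => c'' U * f'' U) (fun U => c U * f U) V * h V ∂fieldMeasure P j G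
      = ∫ V, c V * f V * h V ∂fieldMeasure P j G := by
  -- move `h` into the integrated piece: `normTerm(ins, old)·h = normTerm(ins, old·h)`, and `(c·f)·h = c·(f·h)`
  have hfh : (fun U => (fun U => c U * f U) U * h U) = fun U => c U * (f U * h U) := funext fun U => mul_assoc _ _ _
  have hpt : ∀ V, normTerm s (fun U => c'' U * f'' U) (fun U => c U * f U) V * h V
      = normTerm s (fun U => c'' U * f'' U) (fun U => c U * (f U * h U)) V := fun V => by
    rw [normTerm_mul_eq_of_fibreIndep s (fun U => c'' U * f'' U) (old := fun U => c U * f U) (hcm.mul hP.old_meas) hh hh0 V, hfh]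
  simp_rw [hpt]
  rw [integral_factor_normTerm_eq_of_le s (hP.mul hhm hh0 hhB) hcm hc''m hc hc'' hc0 hc''0 hcB hle]
  exact integral_congr_ae (Filter.Eventually.of_forall fun V => (mul_assoc _ _ _).symm)

end TestFunction

/-! ## §2 The marginal of every fibre-independent statistic: 20n's `hoff`∕`hN` shape at the current field -/

section Marginal

omit [GaugeGroup G] [MeasurableSpace G] [HaarData G] in
/-- A function of a fibre-independent statistic is fibre-independent. [folklore] -/
theorem fibreIndep_comp_statistic (s : Finset (PBond P j)) {u : GaugeField P j G → ℝ} (hu : FibreIndep s u) (g : ℝ → ℝ) :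
    FibreIndep s (fun V => g (u V)) := fun x y => congrArg g (hu x y)

omit [DecidableEq (PBond P j)] in
/-- The `ofReal`-lintegral of a nonnegative integrable density over `u ⁻¹ B` is `ofReal` of the real integral against the test function `1_B ∘ u`. [folklore] -/
theorem lintegral_ofReal_preimage_eq {ρ : Density P j G} (hρi : Integrable ρ (fieldMeasure P j G)) (hρ0 : ∀ V, 0 ≤ ρ V)
    {u : GaugeField P j G → ℝ} (hum : Measurable u) {Bset : Set ℝ} (hB : MeasurableSet Bset) :
    ∫⁻ V in u ⁻¹' Bset, ENNReal.ofReal (ρ V) ∂fieldMeasure P j G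
      = ENNReal.ofReal (∫ V, ρ V * Bset.indicator (fun _ => (1 : ℝ)) (u V) ∂fieldMeasure P j G) := by
  have hind : ∀ V, ρ V * Bset.indicator (fun _ => (1 : ℝ)) (u V) = (u ⁻¹' Bset).indicator ρ V := fun V => by
    by_cases hV : u V ∈ Bset
    · rw [Set.indicator_of_mem hV, Set.indicator_of_mem (Set.mem_preimage.2 hV), mul_one]
    · rw [Set.indicator_of_notMem hV, Set.indicator_of_notMem (fun h => hV (Set.mem_preimage.1 h)), mul_zero]
  simp_rw [hind]
  rw [integral_indicator (hum hB), ofReal_integral_eq_lintegral_ofReal hρi.integrableOn (Filter.Eventually.of_forall fun V => hρ0 V)]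

/-- ★★ **THE (N)∕(Eoff) BINDER OF THE RESAMPLING TOWER AT THE CURRENT FIELD IS A THEOREM OF THE TYPED (0.3)**: for fibre-independent bounded sharp
factors `c ≤ c″`, provisos on the factor-free parts, and a measurable FIBRE-INDEPENDENT statistic `u`, the `u`-marginal of the post-ℝ summand's law
equals the `u`-marginal of the sender's law — 20n's `hoff`∕`hN` shape `(J s).map u = (Jpre s).map u` with `J s := dV·normTerm(s)(c″f″)(c f)`,
`Jpre s := dV·(c f)`. [cite: Balaban1989LargeFieldI, (0.3)–(0.4) p.176] -/
theorem map_withDensity_rstepSummand_eq_of_le (s : Finset (PBond P j)) {c c'' f f'' : Density P j G} {C B : ℝ}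
    (hP : TermProvisos s f'' f C) (hcm : Measurable c) (hc''m : Measurable c'') (hc : FibreIndep s c) (hc'' : FibreIndep s c'')
    (hc0 : ∀ V, 0 ≤ c V) (hc''0 : ∀ V, 0 ≤ c'' V) (hcB : ∀ V, c V ≤ B) (hle : ∀ V, c V ≤ c'' V)
    {u : GaugeField P j G → ℝ} (hum : Measurable u) (hu : FibreIndep s u) :
    ((fieldMeasure P j G).withDensity fun V => ENNReal.ofReal (normTerm s (fun U => c'' U * f'' U) (fun U => c U * f U) V)).map u
      = ((fieldMeasure P j G).withDensity fun V => ENNReal.ofReal (c V * f V)).map u := by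
  -- integrability and nonnegativity of the two densities
  have hcB' : ∀ V, |c V| ≤ max B 0 := fun V => by rw [abs_of_nonneg (hc0 V)]; exact (hcB V).trans (le_max_left _ _)
  have hpost_eq : ∀ V, normTerm s (fun U => c'' U * f'' U) (fun U => c U * f U) V = c V * normTerm s f'' f V := fun V =>
    normTerm_factor_mul_of_le s hP.old_meas hP.ins_meas hc hc'' hc0 hc''0 V (hle V)
  have hpost0 : ∀ V, 0 ≤ normTerm s (fun U => c'' U * f'' U) (fun U => c U * f U) V := fun V => by
    rw [hpost_eq V]; exact mul_nonneg (hc0 V) (normTerm_factor_nonneg s hP.ins_nonneg V)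
  have hposti : Integrable (normTerm s (fun U => c'' U * f'' U) (fun U => c U * f U)) (fieldMeasure P j G) :=
    ((integrable_mul_bdd hP.integrable_normTerm hcm hcB').congr (Filter.Eventually.of_forall fun V => mul_comm _ _)).congr
      (Filter.Eventually.of_forall fun V => (hpost_eq V).symm)
  have hpre0 : ∀ V, 0 ≤ c V * f V := fun V => mul_nonneg (hc0 V) (hP.old_nonneg V)
  have hprei : Integrable (fun V => c V * f V) (fieldMeasure P j G) :=
    (integrable_mul_bdd hP.integrable_old hcm hcB').congr (Filter.Eventually.of_forall fun V => mul_comm _ _)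
  ext Bset hB
  have hh0 : ∀ V : GaugeField P j G, 0 ≤ Bset.indicator (fun _ => (1 : ℝ)) (u V) := fun V =>
    Set.indicator_nonneg (fun _ _ => zero_le_one) _
  have hh1 : ∀ V : GaugeField P j G, Bset.indicator (fun _ => (1 : ℝ)) (u V) ≤ 1 := fun V =>
    Set.indicator_apply_le' (fun _ => le_rfl) (fun _ => zero_le_one)
  rw [Measure.map_apply hum hB, Measure.map_apply hum hB, withDensity_apply _ (hum hB), withDensity_apply _ (hum hB),
    lintegral_ofReal_preimage_eq hposti hpost0 hum hB, lintegral_ofReal_preimage_eq hprei hpre0 hum hB,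
    integral_factor_normTerm_mul_eq_of_le s hP hcm hc''m hc hc'' hc0 hc''0 hcB hle (h := fun V => Bset.indicator (fun _ => (1 : ℝ)) (u V))
      (Bh := 1) ((measurable_const.indicator hB).comp hum) (fibreIndep_comp_statistic s hu _) hh0 hh1]

end Marginal

/-! ## §3 The ON side in def-R's letters: `hon` with `δ_loc` = the sup of the fibre-RATIO sum (FILE 7 `rratio`) -/

section OnRatio

open Literature.MathematicalPhysics.QuantumFieldTheory.Balaban1983to89.Node00 (rterm rratio)

/-- ONE ON SUMMAND: if the fibre ratio `∫⌈_s old ∕ ∫⌈_s new` is bounded by `δa` pointwise and `new ≥ 0` is measurable, the law with density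
`normTerm(s)(new)(old) = new·(ratio)` is `≤ δa ×` the law with density `new`. [cite: Balaban1989LargeFieldI, (0.3) p.176] -/
theorem withDensity_normTerm_le_smul (s : Finset (PBond P j)) {new old : Density P j G} (hm : Measurable new) (h0 : ∀ V, 0 ≤ new V)
    {δa : ℝ} (hδ0 : 0 ≤ δa) (hratio : ∀ V, fibreIntegral s old V / fibreIntegral s new V ≤ δa) :
    ((fieldMeasure P j G).withDensity fun V => ENNReal.ofReal (normTerm s new old V))
      ≤ ENNReal.ofReal δa • (fieldMeasure P j G).withDensity fun V => ENNReal.ofReal (new V) := by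
  rw [← withDensity_smul (ENNReal.ofReal δa) (f := fun V => ENNReal.ofReal (new V)) (ENNReal.measurable_ofReal.comp hm)]
  refine withDensity_mono (Filter.Eventually.of_forall fun V => ?_)
  show ENNReal.ofReal (new V * (fibreIntegral s old V / fibreIntegral s new V)) ≤ ENNReal.ofReal δa * ENNReal.ofReal (new V)
  rw [← ENNReal.ofReal_mul hδ0, mul_comm δa]
  exact ENNReal.ofReal_le_ofReal (mul_le_mul_of_nonneg_left (hratio V) (h0 V))

variable {R : Type*}

/-- ★ **THE ON PRE-IMAGES OF ONE RECEIVER**: with per-sender ratio bounds `δ a` on a finite set `On` of senders sharing the receiver `new`,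
`Σ_{a ∈ On} dV·normTerm(fib a)(new)(old a) ≤ (Σ_{a ∈ On} δ a) • dV·new` — 20n's `hon` with the OFF side reduced to the receiving term alone, and
`δ_loc := Σ_{a ∈ On} sup_V ratio_a` (lens Card 30). [cite: Balaban1989LargeFieldI, (0.3) p.176] -/
theorem sum_withDensity_normTerm_le_smul (On : Finset R) (fib : R → Finset (PBond P j)) {new : Density P j G} (old : R → Density P j G)
    (hm : Measurable new) (h0 : ∀ V, 0 ≤ new V) (δ : R → ℝ) (hδ0 : ∀ a ∈ On, 0 ≤ δ a)
    (hratio : ∀ a ∈ On, ∀ V, fibreIntegral (fib a) (old a) V / fibreIntegral (fib a) new V ≤ δ a) :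
    ∑ a ∈ On, ((fieldMeasure P j G).withDensity fun V => ENNReal.ofReal (normTerm (fib a) new (old a) V))
      ≤ ENNReal.ofReal (∑ a ∈ On, δ a) • (fieldMeasure P j G).withDensity fun V => ENNReal.ofReal (new V) := by
  rw [ENNReal.ofReal_sum_of_nonneg hδ0, Finset.sum_smul]
  exact Finset.sum_le_sum fun a ha => withDensity_normTerm_le_smul (fib a) hm h0 (hδ0 a ha) (hratio a ha)

/-- ★★ **`hon` IN def-R's LETTERS, for every statistic**: the `u`-marginals of the ON summands of one receiver are `≤ δ_loc ×` the receiver's pre-ℝ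
`u`-marginal. [cite: Balaban1989LargeFieldI, (0.3) p.176] -/
theorem sum_map_withDensity_normTerm_le (On : Finset R) (fib : R → Finset (PBond P j)) {new : Density P j G} (old : R → Density P j G)
    (hm : Measurable new) (h0 : ∀ V, 0 ≤ new V) (δ : R → ℝ) (hδ0 : ∀ a ∈ On, 0 ≤ δ a)
    (hratio : ∀ a ∈ On, ∀ V, fibreIntegral (fib a) (old a) V / fibreIntegral (fib a) new V ≤ δ a)
    {u : GaugeField P j G → ℝ} (hum : Measurable u) :
    ∑ a ∈ On, ((fieldMeasure P j G).withDensity fun V => ENNReal.ofReal (normTerm (fib a) new (old a) V)).map u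
      ≤ ENNReal.ofReal (∑ a ∈ On, δ a) • ((fieldMeasure P j G).withDensity fun V => ENNReal.ofReal (new V)).map u := by
  rw [← Measure.map_smul]
  refine le_trans ?_ (Measure.map_mono (sum_withDensity_normTerm_le_smul On fib old hm h0 δ hδ0 hratio) hum)
  classical
  refine Finset.induction_on On (by simp) fun a On' ha ih => ?_
  rw [Finset.sum_insert ha, Finset.sum_insert ha, Measure.map_add _ _ hum]
  exact add_le_add le_rfl ih

/-- **THE SUMMANDS OF `δ_loc` ARE def-R's `rratio`**: FILE 7's R-stepped summand of sender `a` to receiver `a′` is `rterm r a′ · rratio r fib a a′`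
pointwise (definitional). [cite: Balaban1989LargeFieldI, (0.3) p.176 (bookkeeping)] -/
theorem normTerm_rterm_eq_mul_rratio (r : Step.Repr218 P G j) (fib : r.Adm → Finset (PBond P j)) (a a' : r.Adm) (V : GaugeField P j G) :
    normTerm (fib a) (rterm r a') (rterm r a) V = rterm r a' V * rratio r fib a a' V := rfl

end OnRatio

/-! ## §4 Guard (non-vacuity): the hypothesis bundle of files 20∕23 is inhabited -/

section Guard

/-- The real fibre integral of the constant `1` is `1` (normalised Haar fibres). [folklore] -/
theorem fibreIntegral_one (s : Finset (PBond P j)) (V : GaugeField P j G) : fibreIntegral s (fun _ => (1 : ℝ)) V = 1 := by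
  unfold fibreIntegral
  rw [B15.BasicStep.lmarginal_of_indepOf s (f := fun _ => ENNReal.ofReal 1) (fun _ _ => rfl)]
  simp

/-- **THE THRESHOLD-FREE PROVISOS ARE SATISFIABLE**: the constant slots `f = f″ = 1` satisfy `TermProvisos s 1 1 1` for EVERY fibre `s` (denominator
`∫⌈_s 1 = 1 ≠ 0`) — in contrast with b01's `hden` on indicator-carrying receivers (file 20's located note). [folklore] -/
theorem termProvisos_one (s : Finset (PBond P j)) : TermProvisos s (fun _ : GaugeField P j G => (1 : ℝ)) (fun _ => (1 : ℝ)) 1 where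
  ins_meas := measurable_const
  old_meas := measurable_const
  ins_nonneg _ := zero_le_one
  old_nonneg _ := zero_le_one
  ins_le _ := le_rfl
  old_le _ := le_rfl
  den_ne V := by rw [fibreIntegral_one s V]; exact one_ne_zero

/-- ★ **NON-VACUITY OF ★★ `integral_ropReal_factor_eq_of_le`**: at the constant data `c = f = 1` (any finite index type, any selector, any fibres) every
hypothesis holds and the conclusion reads `∫ ℝ(1) dV = Σ_a ∫ 1 dV`. [folklore] -/
theorem integral_ropReal_factor_eq_of_le_inhabited {R : Type*} [Fintype R] (sel : R → R) (fib : R → Finset (PBond P j)) :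
    ∫ V, B15.BasicStep.RopReal (fun (_ : R) (_ : GaugeField P j G) => (1 : ℝ) * 1) sel fib V ∂fieldMeasure P j G
      = ∑ _a : R, ∫ _V : GaugeField P j G, (1 : ℝ) * 1 ∂fieldMeasure P j G :=
  integral_ropReal_factor_eq_of_le (fun _ _ => (1 : ℝ)) (fun _ _ => (1 : ℝ)) sel fib (C := 1) (B := 1) (fun a => termProvisos_one (fib a))
    (fun _ => measurable_const) (fun _ _ _ => rfl) (fun _ _ _ => rfl) (fun _ _ => zero_le_one)
    (fun _ _ => le_rfl) fun _ _ => le_rfl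

end Guard

end Summit.QuantumFields.YangMills.Theorems.N21ThresholdMixtureRStepMarginals

end
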